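import Summits.HodgeConjecture.CorCM.SimpleCMSurfacePairsHodge
import HarnessLib

/-!
# A simple CM abelian surface times ANY CM abelian variety whose Galois closure does not contain the surface's:
# the Hodge conjecture on every `S^a × A^b`

COR-CM (cell `pub-hodgecm2`, binder seat `b23` gen 28), count-neutral; NEW as stated, hence under `Summits/`.  Sequel of
`SimpleCMSurfacePairsHodge` (this seat): there the proper normal subfields of the Galois closure `L_S` of a quartic CM
field which is not biquadratic were shown to be TOTALLY REAL.  Consequence for a second slot carrying an ARBITRARY CM
field `K_{i₁}` with closure `L₁`: if `L_S ⊄ L₁` then `L_S ∩ L₁` is a proper normal subfield of `L_S`, hence fixed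
pointwise by complex conjugation, so both slots carry PARTIAL CONJUGATIONS:

* **`conj_apply_eq_of_mem_inf_of_not_le`** — `K_{i₀}` quartic CM, not biquadratic, `¬ L₀ ≤ L₁`: conjugation fixes
  `L₀ ∩ L₁` pointwise;
* **`hodgeConjectureFor_prod_surface_times_of_not_le`** — with `Φ_{i₁}` nondegenerate: the Hodge conjecture and
  `B• = D•` on every `S^a × A^b` (every `⨁_{j<N} A_{π j}`), UNCONDITIONALLY;
* **`hodgeConjectureFor_prod_simpleSurface_times_of_not_le`** — the same for a SIMPLE CM abelian surface `S` (any
  quartic CM field, any type) and any realisation `A` of a nondegenerate CM type whose Galois closure does not contain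
  `L_S` — e.g. `A` simple of prime dimension `p` with `[L_A : ℚ]` not divisible by `[L_S : ℚ] ∈ {4, 8}`;
* `isNondegenerateFamily_iff_surface_times_of_not_le` — for all types: the pair is nondegenerate iff `Φ_{i₁}` is.

(`L_S ≤ L₁` does occur — `K_{i₁} ⊇` a copy of `K_S`, or `K_{i₁}` the reflex field — and then both outcomes are possible:
`QuarticCMReflexPairHodge`, `CMFamilyRankClosureBound`.)  Theorems only, no definition, no `sorry`.

## References

* [Shimura1998] G. Shimura, *Abelian Varieties with Complex Multiplication and Modular Functions*, §8.4 Example (2).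
* [Gordon1999HodgeAVSurvey] B. B. Gordon, *A survey of the Hodge conjecture for abelian varieties*, §3 Theorem (proof),
  7.5, 10.10.
* [MoonenZarhin1999LowDim] B. Moonen, Yu. Zarhin, Math. Ann. 315 (1999), Cor. (3.9).
-/

noncomputable section

open CategoryTheory CategoryTheory.Limits NumberField NumberField.ComplexEmbedding IntermediateField Module

namespace Summit.HodgeConjecture.CorCM

open Literature.NumberTheory.ComplexMultiplication
open Literature.AlgebraicGeometry.Motives (AbelianVariety CMType)
open Literature.AlgebraicGeometry.HodgeTheory
open Literature.AlgebraicGeometry.ComplexMultiplication (IsCMTypeRealisation isSimple_iff_isPrimitive)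
open Literature.AlgebraicGeometry.VanGeemen1994 (hodgeClassSpan)
open Literature.AlgebraicGeometry.Pohlmann1968
open Literature.Barriers.HodgeConjecture (divisorClassesSpan)

section Fields

variable {I : Type} {K : I → Type} [∀ i, Field (K i)] [∀ i, NumberField (K i)] [∀ i, IsCMField (K i)]

/-- A subfield of a finite extension (inside `ℂ`) is finite. [folklore] -/
private theorem finiteDimensional_of_le₁₀ {E E' : IntermediateField ℚ ℂ} [FiniteDimensional ℚ E] (h : E' ≤ E) :
    FiniteDimensional ℚ E' :=
  FiniteDimensional.of_injective (IntermediateField.inclusion h).toLinearMap (IntermediateField.inclusion_injective h)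

/-- **A quartic CM field (not biquadratic) whose Galois closure is not contained in that of the partner: conjugation
fixes `L₀ ∩ L₁` pointwise** — `L₀ ∩ L₁` is a proper normal subfield of `L₀`, hence totally real.
[cite: Shimura1998, §8.4 Example (2)] -/
theorem conj_apply_eq_of_mem_inf_of_not_le {i₀ i₁ : I} (h4₀ : finrank ℚ (K i₀) = 4)
    (hK₀ : ¬ (IsGalois ℚ (K i₀) ∧ ¬ IsCyclic (K i₀ ≃ₐ[ℚ] K i₀)))
    (hnle : ¬ normalClosure ℚ (K i₀) ℂ ≤ normalClosure ℚ (K i₁) ℂ) {x : ℂ} (h₀ : x ∈ normalClosure ℚ (K i₀) ℂ)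
    (h₁ : x ∈ normalClosure ℚ (K i₁) ℂ) : starRingEnd ℂ x = x := by
  haveI : ∀ j : I, @Normal ℚ ↥(normalClosure ℚ (K j) ℂ) _ _ (IntermediateField.algebra' _) :=
    normal_normalClosure_complex
  letI : Algebra ℚ ↥(normalClosure ℚ (K i₀) ℂ ⊓ normalClosure ℚ (K i₁) ℂ) := IntermediateField.algebra' _
  haveI : FiniteDimensional ℚ ↥(normalClosure ℚ (K i₀) ℂ ⊓ normalClosure ℚ (K i₁) ℂ) :=
    finiteDimensional_of_le₁₀ inf_le_left
  have hne : normalClosure ℚ (K i₀) ℂ ⊓ normalClosure ℚ (K i₁) ℂ ≠ normalClosure ℚ (K i₀) ℂ :=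
    fun h => hnle (h ▸ inf_le_right)
  exact conj_apply_eq_of_ne_normalClosure_quartic i₀ h4₀ hK₀ _ inf_le_left hne (IntermediateField.mem_inf.2 ⟨h₀, h₁⟩)

end Fields

section Geometry

variable {I : Type} {K : I → Type} [∀ i, Field (K i)] [∀ i, NumberField (K i)] [∀ i, IsCMField (K i)] [Fintype I]
  [Nonempty I] {Φ : ∀ i, CMType (K i)}
variable {A : I → AbelianVariety ℂ} {ι : ∀ i, 𝓞 (K i) →+* End (A i)}
  {θ : ∀ i, K i →+* Module.End ℂ (complexBetti (A i).X 1)}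

/-- **For all types: the pair is nondegenerate iff `Φ_{i₁}` is** (`K_{i₀}` quartic CM not biquadratic, `L₀ ⊄ L₁`; every
type of `K_{i₀}` is nondegenerate). [cite: Gordon1999HodgeAVSurvey, §3 Theorem and 7.5] -/
theorem isNondegenerateFamily_iff_surface_times_of_not_le {i₀ i₁ : I} (h01 : i₀ ≠ i₁) (hI : ∀ j, j = i₀ ∨ j = i₁)
    (h4₀ : finrank ℚ (K i₀) = 4) (hK₀ : ¬ (IsGalois ℚ (K i₀) ∧ ¬ IsCyclic (K i₀ ≃ₐ[ℚ] K i₀)))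
    (hnle : ¬ normalClosure ℚ (K i₀) ℂ ≤ normalClosure ℚ (K i₁) ℂ) :
    CMAlgebra.IsNondegenerateFamily Φ ↔ IsNondegenerate (Φ i₁) := by
  rw [isNondegenerateFamily_iff_of_partialConj (forall_exists_partialConj_pair h01 hI fun x hx₀ hx₁ =>
    conj_apply_eq_of_mem_inf_of_not_le h4₀ hK₀ hnle hx₀ hx₁) Φ]
  refine ⟨fun h => h i₁, fun h i => ?_⟩
  rcases hI i with rfl | rfl
  · exact isNondegenerate_of_quartic_not_biquadratic _ h4₀ hK₀ (Φ _)
  · exact h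

/-- **A surface with CM by a quartic field (not biquadratic) times ANY realisation of a nondegenerate CM type whose
Galois closure does not contain the surface's: the Hodge conjecture and `B• = D•` on every `S^a × A^b`**
(every `⨁_{j<N} A_{π j}`), UNCONDITIONALLY. [cite: Gordon1999HodgeAVSurvey, §3 Theorem and 10.10] [cite: Shimura1998, §8.4 Example (2)] -/
theorem hodgeConjectureFor_prod_surface_times_of_not_le {i₀ i₁ : I} (h01 : i₀ ≠ i₁) (hI : ∀ j, j = i₀ ∨ j = i₁)
    (h4₀ : finrank ℚ (K i₀) = 4) (hK₀ : ¬ (IsGalois ℚ (K i₀) ∧ ¬ IsCyclic (K i₀ ≃ₐ[ℚ] K i₀)))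
    (hnle : ¬ normalClosure ℚ (K i₀) ℂ ≤ normalClosure ℚ (K i₁) ℂ) (hΦ₁ : IsNondegenerate (Φ i₁))
    (hA : ∀ i, IsCMTypeRealisation (Φ i) (A i) (ι i) (θ i)) {N : ℕ} (π : Fin N → I) :
    HodgeConjectureFor (⨁ fun j : Fin N => A (π j)).dim (⨁ fun j : Fin N => A (π j)).X ∧
      ∀ m : ℕ, hodgeClassSpan (⨁ fun j : Fin N => A (π j)).dim (⨁ fun j : Fin N => A (π j)).X m =
        divisorClassesSpan (⨁ fun j : Fin N => A (π j)).X (⨁ fun j : Fin N => A (π j)).dim m :=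
  have hnd := (isNondegenerateFamily_iff_surface_times_of_not_le (Φ := Φ) h01 hI h4₀ hK₀ hnle).2 hΦ₁
  ⟨hnd.hodgeConjectureFor_prod hA π, fun m => hnd.hodgeClassSpan_prod_eq_divisorClassesSpan hA π m⟩

/-- **A SIMPLE CM abelian surface `S` times any realisation `A` of a nondegenerate CM type whose Galois closure does not
contain `L_S`: the Hodge conjecture and `B• = D•` on every `S^a × A^b`** — e.g. `A` simple of odd prime dimension `p`
with Galois CM field (`[L_A : ℚ] = 2p` is not divisible by `4`), or any `A` with `[L_A : ℚ]` not divisible by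
`[L_S : ℚ]`. [cite: Gordon1999HodgeAVSurvey, §3 Theorem and 10.10] [cite: MoonenZarhin1999LowDim, Cor. (3.9)] -/
theorem hodgeConjectureFor_prod_simpleSurface_times_of_not_le {i₀ i₁ : I} (h01 : i₀ ≠ i₁)
    (hI : ∀ j, j = i₀ ∨ j = i₁) (h4₀ : finrank ℚ (K i₀) = 4)
    (hnle : ¬ normalClosure ℚ (K i₀) ℂ ≤ normalClosure ℚ (K i₁) ℂ) (hΦ₁ : IsNondegenerate (Φ i₁))
    (hA : ∀ i, IsCMTypeRealisation (Φ i) (A i) (ι i) (θ i)) (hS : (A i₀).IsSimple) {N : ℕ} (π : Fin N → I) :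
    HodgeConjectureFor (⨁ fun j : Fin N => A (π j)).dim (⨁ fun j : Fin N => A (π j)).X ∧
      ∀ m : ℕ, hodgeClassSpan (⨁ fun j : Fin N => A (π j)).dim (⨁ fun j : Fin N => A (π j)).X m =
        divisorClassesSpan (⨁ fun j : Fin N => A (π j)).X (⨁ fun j : Fin N => A (π j)).dim m :=
  hodgeConjectureFor_prod_surface_times_of_not_le h01 hI h4₀
    (not_biquadratic_of_isPrimitive i₀ h4₀ ((isSimple_iff_isPrimitive (hA i₀) (Classical.arbitrary (K i₀ →+* ℂ))).1 hS))
    hnle hΦ₁ hA π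

omit [∀ i, IsCMField (K i)] [Fintype I] [Nonempty I] in
/-- **Degree test for `L_S ⊄ L₁`**: if `[L₁ : ℚ]` is not a multiple of `[L_S : ℚ]` then `L_S ⊄ L₁`. [folklore] -/
theorem not_le_of_not_dvd_finrank {i₀ i₁ : I}
    (h : ¬ finrank ℚ ↥(normalClosure ℚ (K i₀) ℂ) ∣ finrank ℚ ↥(normalClosure ℚ (K i₁) ℂ)) :
    ¬ normalClosure ℚ (K i₀) ℂ ≤ normalClosure ℚ (K i₁) ℂ :=
  fun hle => h (IntermediateField.finrank_dvd_of_le_right hle)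

/-- **A simple CM abelian surface times a simple CM abelian variety of ODD PRIME dimension with GALOIS CM field: the
Hodge conjecture on every `S^a × A^b`** — `[L_A : ℚ] = 2p` is not a multiple of `4 ∣ [L_S : ℚ]`, and primitive types in
prime degree are nondegenerate (Yanai). [cite: Gordon1999HodgeAVSurvey, §3 Theorem, Thm. 6.3 Remark and 10.10] -/
theorem hodgeConjectureFor_prod_simpleSurface_times_primeGalois {i₀ i₁ : I} (h01 : i₀ ≠ i₁)
    (hI : ∀ j, j = i₀ ∨ j = i₁) (h4₀ : finrank ℚ (K i₀) = 4) {p : ℕ} (hp : p.Prime) (hp2 : p ≠ 2)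
    [IsGalois ℚ (K i₁)] (h₁ : finrank ℚ (K i₁) = 2 * p)
    (hA : ∀ i, IsCMTypeRealisation (Φ i) (A i) (ι i) (θ i)) (hS : ∀ i, (A i).IsSimple) {N : ℕ} (π : Fin N → I) :
    HodgeConjectureFor (⨁ fun j : Fin N => A (π j)).dim (⨁ fun j : Fin N => A (π j)).X ∧
      ∀ m : ℕ, hodgeClassSpan (⨁ fun j : Fin N => A (π j)).dim (⨁ fun j : Fin N => A (π j)).X m =
        divisorClassesSpan (⨁ fun j : Fin N => A (π j)).X (⨁ fun j : Fin N => A (π j)).dim m := by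
  refine hodgeConjectureFor_prod_simpleSurface_times_of_not_le h01 hI h4₀ (not_le_of_not_dvd_finrank fun hdvd => ?_)
    ?_ hA (hS i₀) π
  · -- `4 ∣ [L₀ : ℚ] ∣ [L₁ : ℚ] = 2p`, `p` odd: impossible
    have hL₁ : finrank ℚ ↥(normalClosure ℚ (K i₁) ℂ) = 2 * p := (finrank_normalClosure_of_normal (K := K i₁)).trans h₁
    obtain ⟨s₀⟩ : Nonempty (K i₀ →+* ℂ) := inferInstance
    haveI : FiniteDimensional ℚ ↥s₀.toRatAlgHom.fieldRange :=
      finiteDimensional_of_le₁₀ (AlgHom.fieldRange_le_normalClosure s₀.toRatAlgHom)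
    have h4L₀ : 4 ∣ finrank ℚ ↥(normalClosure ℚ (K i₀) ℂ) := by
      have h := IntermediateField.finrank_dvd_of_le_right (AlgHom.fieldRange_le_normalClosure s₀.toRatAlgHom)
      have h4s : finrank ℚ ↥s₀.toRatAlgHom.fieldRange = 4 := by
        rw [← h4₀]; exact (AlgEquiv.ofInjectiveField s₀.toRatAlgHom).toLinearEquiv.finrank_eq.symm
      rwa [h4s] at h
    have h4p : 4 ∣ 2 * p := hL₁ ▸ h4L₀.trans hdvd
    have : 2 ∣ p := by
      have h22 : 2 * 2 ∣ 2 * p := h4p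
      exact Nat.dvd_of_mul_dvd_mul_left two_pos h22
    rcases (Nat.dvd_prime hp).1 this with h | h
    · exact absurd h (by norm_num)
    · exact hp2 h.symm
  · obtain ⟨φ₀⟩ : Nonempty (K i₁ →+* ℂ) := inferInstance
    exact isNondegenerate_of_isPrimitive_of_prime hp h₁ φ₀
      ((isSimple_iff_isPrimitive (hA i₁) φ₀).1 (hS i₁))

end Geometry

end Summit.HodgeConjecture.CorCM

end
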